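import Summits.HodgeConjecture.HodgeConjecture.Theorems.Ring2WeilCoverageWeilGramLevel33Xi
import Summits.HodgeConjecture.HodgeConjecture.Theorems.Ring2WeilCoverageWeilGramLevel33XiSqrtNegThree
import Summits.HodgeConjecture.HodgeConjecture.Theorems.Ring2WeilCoverageWeilGramSign
import Summits.HodgeConjecture.HodgeConjecture.Theorems.Ring2WeilCoverageCyclotomicUnconditionalSqrtNegEleven
import Summits.HodgeConjecture.HodgeConjecture.Theorems.Ring2WeilCoverageCyclotomicSignaturesG10
import HarnessLib

/-!
# Weil-type family coverage — THE COMPONENTS OF THE WEIL-TYPE `ℤ[ζ₃₃]`-TENFOLDS, IV: `θ^i` (`i < 10`) is a `ℚ`-basis of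
# `ℚ(ζ₃₃)⁺`; EVERY principal-type `E_ζ′` has Gram determinant `164916224` against `√−11` — hence NO principal-type
# `E_ζ′` is `Φ`-positive on a `ℚ(√−11)`-Weil-type CM type (the NO row `(33, ℚ(√−11))` from van Geemen's SIGN) — and
# `-248832` against `√−3`: the principally polarised Weil-type `ℤ[ζ₃₃]`-tenfolds for `ℚ(√−3)` lie on the SPLIT row

research route conditional on HC_CM; not a corollary; Q11.4-sentence-2 already refuted in dim ≥ 3.

Ring 2, WEIL-TYPE FAMILY-COVERAGE CENSUS (`HOME/WEIL-FAMILY-COVERAGE.md` `## b01`, blocks b01.34 (the NO row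
`(ℚ(ζ₃₃), √−11)`, the YES row `(ℚ(ζ₃₃), √−3)`), b01.41 (C), b01.48 NEXT), part 123 of the `Ring2WeilCoverage*` series;
continues parts 121/122 (`Ring2WeilCoverageWeilGramLevel33Xi`, `…XiSqrtNegThree`: traces, Hankel matrices, determinants).

* §2 `[ℚ(ζ₃₃)⁺ : ℚ] = 10` and **`1, θ, …, θ⁹` is a `ℚ`-basis of `ℚ(ζ₃₃)⁺`** (a relation is in the kernel of the Gram
  matrix of part 121, whose determinant is non-zero).
* §3 **EVERY skew `ζ′` of principal type on `ℤ[ζ₃₃]` gives `det a = 164916224`** against `s₁₁` (part 82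
  `det_realPart_eq_of_isOfType` + THEOREM L (i) at `33`, `norm_realUnits_pos_thirtyThree`); **NO such `ζ′` is
  `Φ`-positive on a CM type of `s₁₁`-signature `(5,5)`**: `(−1)⁵·164916224 < 0` against part 92 — the census verdict
  at `(33, ℚ(√−11))` (part 31: unit signatures) by a second, independent kernel route (van Geemen's sign of `det H`).
* §4 against `s₃`: **EVERY principal-type `ζ′` gives `-248832`**; such `Φ`-positive `ζ′` exist on every
  `ℚ(√−3)`-balanced `Φ` (`exists_principal_thirtyThree_sqrt_neg_three`, THEOREM L (ii) at `33`) — CENSUS FORM; class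
  **`[-248832] = [−1]·[3·288²] = splitDiscriminantClass 5 3`**: the principally polarised Weil-type `ℤ[ζ₃₃]`-CM
  tenfolds for `ℚ(√−3)` lie on the SPLIT component (census row W10.3.1; b02.1 (F3) for these points, kernel).

HONEST FRAMING as parts 120/121; `HC_CM` is used nowhere.  No `def`, no named fact, no `sorry`.

References: [cite: vanGeemen1994HodgeAV, Lemma 5.2 (2)–(4), 5.4 and (5.4.1)]; [cite: Shimura1998, §14.3 Prop. 4–5,
pp. 103–104]; census b01.34, b01.41 (C) (seat-derived).
-/

noncomputable section

open Polynomial NumberField Module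
open scoped nonZeroDivisors

namespace Summit.HodgeConjecture.Ring2WeilCoverage.WeilGramLevel33Principal

open Literature.AlgebraicGeometry.VanGeemen1994 (weilField weilNormResidueGroup)
open Literature.AlgebraicGeometry.Motives (CMType normUnitsSubgroup)
open Literature.NumberTheory.ComplexMultiplication
open Summit.HodgeConjecture.Ring2WeilCoverage.WeilGramTools
open Summit.HodgeConjecture.Ring2WeilCoverage.WeilGramCMPoint
open Summit.HodgeConjecture.Ring2WeilCoverage.RealUnitNormHalfSystems (complexConj_eq_inv)
open Summit.HodgeConjecture.Ring2WeilCoverage.CyclotomicPrincipalObstruction (complexConj_xi)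
open Summit.HodgeConjecture.Ring2WeilCoverage.CyclotomicDifferent (isOfType_one_xi_top xi_ne_zero)
open Summit.HodgeConjecture.HodgeConjecture.Ring2.WeilCoverage (mk_neg_eq_split_of_odd mk_neg_ne_split_of_odd
  mk_eq_split_of_even mk_ne_split_of_even mem_normUnitsSubgroup_of_sq_add_mul_sq natCast_not_mem_normUnitsSubgroup_of_ramified)
open Summit.HodgeConjecture.HodgeConjecture.Ring2.Hypotheses (splitDiscriminantClass)
open Summit.HodgeConjecture.Ring2WeilCoverage.WeilGramLevel33
open Summit.HodgeConjecture.Ring2WeilCoverage.WeilGramLevel33Xi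
open Summit.HodgeConjecture.Ring2WeilCoverage.WeilGramLevel33XiSqrtNegThree
open Summit.HodgeConjecture.Ring2WeilCoverage.WeilGramSign (not_pos_of_neg_one_pow_mul_det_nonpos)
open Summit.HodgeConjecture.Ring2WeilCoverage.CyclotomicUnconditionalSqrtNegEleven (norm_realUnits_pos_thirtyThree)
open Summit.HodgeConjecture.Ring2WeilCoverage.CyclotomicSignaturesG10 (exists_principal_thirtyThree_sqrt_neg_three)
variable {K : Type} [Field K] [NumberField K] {ζ : K}

/-- `𝐞(t) = exp(2πi t/n) ∈ ℂ` (`ZMod.toCircle`). -/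
local notation3 (prettyPrint := false) "𝐞 " t:max => ((ZMod.toCircle t : Circle) : ℂ)

/-- the residue set `S_Φ` read at level `33`. -/
local notation3 (prettyPrint := false) "SΦ[" Φ "," z "]" =>
  (Finset.univ.filter fun t : ZMod 33 => ∃ σ ∈ (Φ : CMType K).1, σ (z : K) = 𝐞 t)

/-! ### §2 `1, θ, …, θ⁹` is a `ℚ`-basis of `K⁺ = ℚ(ζ₃₃)⁺` -/

/-- `[ℚ(ζ_33)⁺ : ℚ] = 10`. [folklore] -/
theorem finrank_realSubfield [IsCyclotomicExtension {33} ℚ K] [IsCMField K] :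
    finrank ℚ (maximalRealSubfield K) = 10 := by
  have h1 : finrank ℚ K = 20 := by
    rw [IsCyclotomicExtension.finrank K (cyclotomic.irreducible_rat (by norm_num : 0 < 33))]; decide
  have h2 := Module.finrank_mul_finrank ℚ (maximalRealSubfield K) K
  rw [Algebra.IsQuadraticExtension.finrank_eq_two (maximalRealSubfield K) K, h1] at h2
  omega

/-- **`1, θ, …, θ^{10−1}` are `ℚ`-linearly independent in `K⁺`**: a relation `Σ cₖ θ^k = 0`, multiplied by `ζ′ s θ^m` and
traced, says that `c` is in the kernel of the Gram matrix `a` of §1, whose determinant is non-zero.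
research route conditional on HC_CM; not a corollary; Q11.4-sentence-2 already refuted in dim ≥ 3. [folklore] -/
theorem linearIndependent_thetaPow [IsCyclotomicExtension {33} ℚ K] [IsCMField K] (hζ : IsPrimitiveRoot ζ 33)
    {ω : Fin 10 → maximalRealSubfield K} (hω : ∀ i, (ω i : K) = (ζ + ζ⁻¹) ^ (i : ℕ)) : LinearIndependent ℚ ω := by
  rw [Fintype.linearIndependent_iff]
  intro c hc
  have hcK : ∑ i : Fin 10, (c i : K) * (ζ + ζ⁻¹) ^ (i : ℕ) = 0 := by
    have h := congrArg (fun y : maximalRealSubfield K => (y : K)) hc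
    simp only [ZeroMemClass.coe_zero] at h
    rw [← h]
    push_cast
    refine Finset.sum_congr rfl fun i _ => ?_
    rw [Rat.smul_def, hω i]
  have E : ∀ m : ℕ, ∑ i : Fin 10, c i * Algebra.trace ℚ K ((ζ ^ 9 * (aeval ζ (derivative (cyclotomic 33 ℚ)))⁻¹) * (1 + 2 * (ζ ^ 3 + ζ ^ 9 + ζ ^ 12 + ζ ^ 15 + ζ ^ 27)) *
      ((ζ + ζ⁻¹) ^ m * (ζ + ζ⁻¹) ^ (i : ℕ))) = 0 := by
    intro m
    have h := congrArg (fun y => Algebra.trace ℚ K ((ζ ^ 9 * (aeval ζ (derivative (cyclotomic 33 ℚ)))⁻¹) * (1 + 2 * (ζ ^ 3 + ζ ^ 9 + ζ ^ 12 + ζ ^ 15 + ζ ^ 27)) * (ζ + ζ⁻¹) ^ m * y)) hcK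
    simp only [mul_zero, map_zero, Finset.mul_sum, map_sum] at h
    rw [← h]
    refine Finset.sum_congr rfl fun i _ => ?_
    rw [show (ζ ^ 9 * (aeval ζ (derivative (cyclotomic 33 ℚ)))⁻¹) * (1 + 2 * (ζ ^ 3 + ζ ^ 9 + ζ ^ 12 + ζ ^ 15 + ζ ^ 27)) * (ζ + ζ⁻¹) ^ m *
        ((c i : K) * (ζ + ζ⁻¹) ^ (i : ℕ)) = (c i) • ((ζ ^ 9 * (aeval ζ (derivative (cyclotomic 33 ℚ)))⁻¹) * (1 + 2 * (ζ ^ 3 + ζ ^ 9 + ζ ^ 12 + ζ ^ 15 + ζ ^ 27)) *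
        ((ζ + ζ⁻¹) ^ m * (ζ + ζ⁻¹) ^ (i : ℕ))) by rw [Rat.smul_def]; ring, map_smul, smul_eq_mul]
  set x : Fin 10 → K := fun i => (ζ + ζ⁻¹) ^ (i : ℕ) with hxdef
  have hx : ∀ i, x i = (ζ + ζ⁻¹) ^ (i : ℕ) := fun i => rfl
  set a : Matrix (Fin 10) (Fin 10) ℚ := Matrix.of fun i j => Algebra.trace ℚ K ((ζ ^ 9 * (aeval ζ (derivative (cyclotomic 33 ℚ)))⁻¹) * x i *
      IsCMField.complexConj K ((1 + 2 * (ζ ^ 3 + ζ ^ 9 + ζ ^ 12 + ζ ^ 15 + ζ ^ 27)) * x j)) with hadef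
  have ha : ∀ i j, a i j = Algebra.trace ℚ K ((ζ ^ 9 * (aeval ζ (derivative (cyclotomic 33 ℚ)))⁻¹) * x i *
      IsCMField.complexConj K ((1 + 2 * (ζ ^ 3 + ζ ^ 9 + ζ ^ 12 + ζ ^ 15 + ζ ^ 27)) * x j)) := fun i j => rfl
  have hdet : a.det ≠ 0 := by
    rw [det_realPart_xi_sqrtNegEleven hζ hx ha]; norm_num
  have ha2 : ∀ i j, a i j = -Algebra.trace ℚ K ((ζ ^ 9 * (aeval ζ (derivative (cyclotomic 33 ℚ)))⁻¹) * (1 + 2 * (ζ ^ 3 + ζ ^ 9 + ζ ^ 12 + ζ ^ 15 + ζ ^ 27)) * (x i * x j)) :=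
    fun i j => by
      have h := congrFun (congrFun (ha_eq (complexConj_sqrtNegEleven hζ) (complexConj_thetaFrame hζ hx) ha) i) j
      rwa [Matrix.of_apply] at h
  have hmv : a.mulVec (fun i => c i) = 0 := by
    funext m
    simp only [Matrix.mulVec, dotProduct, Pi.zero_apply, ha2, hx, neg_mul]
    rw [Finset.sum_neg_distrib, neg_eq_zero, ← E m]
    exact Finset.sum_congr rfl fun i _ => mul_comm _ _
  have h0 := Matrix.eq_zero_of_mulVec_eq_zero hdet hmv
  intro i
  simpa using congrFun h0 i

/-- **A `ℚ`-basis `ωb` of `K⁺ = ℚ(ζ_33)⁺` with `ωb i = θ^i`** (`i < 10`). [folklore] -/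
theorem exists_basis_thetaPow [IsCyclotomicExtension {33} ℚ K] [IsCMField K] (hζ : IsPrimitiveRoot ζ 33) :
    ∃ ωb : Basis (Fin 10) ℚ (maximalRealSubfield K), ∀ i, (ωb i : K) = (ζ + ζ⁻¹) ^ (i : ℕ) := by
  let θ' : maximalRealSubfield K :=
    ⟨ζ + ζ⁻¹, (IsCMField.complexConj_eq_self_iff K (ζ + ζ⁻¹)).mp (complexConj_theta hζ)⟩
  let ω : Fin 10 → maximalRealSubfield K := fun i => θ' ^ (i : ℕ)
  have hω : ∀ i, (ω i : K) = (ζ + ζ⁻¹) ^ (i : ℕ) := fun i => by simp [ω, θ']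
  have hli := linearIndependent_thetaPow hζ hω
  have hcard : Fintype.card (Fin 10) = finrank ℚ (maximalRealSubfield K) := by
    rw [Fintype.card_fin, finrank_realSubfield]
  exact ⟨basisOfLinearIndependentOfCardEqFinrank hli hcard, fun i => by
    rw [coe_basisOfLinearIndependentOfCardEqFinrank]; exact hω i⟩

/-! ### §3 Every principal-type parameter gives `164916224` against `s₁₁`; the NO row `(33, ℚ(√−11))` from the sign -/

/-- **For EVERY skew `ζ′` of PRINCIPAL type on `ℤ[ζ_33]` (`IsOfType 1 ζ′ ⊤`; `ζ′ = uξ`, `u` a real unit, `N(u) = 1`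
by THEOREM L (i) at `33`) the Gram determinant of `(E_ζ′, s₁₁)` in the frame `θ^i` (`i < 10`) is `164916224`** (such `ζ′` exist for SOME `Φ`, but — below — for no `ℚ(√−11)`-Weil-type `Φ`): the census NO row `(33, ℚ(√−11))`;
`(−1)⁵ det a < 0`: the WRONG sign for Weil signature `(5,5)` [vG94 5.2 (4)] — see the NO-row theorem.
research route conditional on HC_CM; not a corollary; Q11.4-sentence-2 already refuted in dim ≥ 3. [cite: vanGeemen1994HodgeAV, Lemma 5.2 (3)–(4) and (5.4.1)] [cite: Shimura1998, §14.3 Prop. 5, p. 104] -/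
theorem det_realPart_principal_sqrtNegEleven [IsCyclotomicExtension {33} ℚ K] [IsCMField K]
    (hζ : IsPrimitiveRoot ζ 33) {ζ' : K} (hζ' : IsCMField.complexConj K ζ' = -ζ')
    (hT : CMTypeLattice.IsOfType (1 : (FractionalIdeal (𝓞 K)⁰ K)ˣ) ζ' ⊤)
    {x : Fin 10 → K} (hx : ∀ i, x i = (ζ + ζ⁻¹) ^ (i : ℕ)) {a : Matrix (Fin 10) (Fin 10) ℚ}
    (ha : ∀ i j, a i j = Algebra.trace ℚ K (ζ' * x i * IsCMField.complexConj K ((1 + 2 * (ζ ^ 3 + ζ ^ 9 + ζ ^ 12 + ζ ^ 15 + ζ ^ 27)) * x j))) :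
    a.det = 164916224 := by
  obtain ⟨ωb, hωb⟩ := exists_basis_thetaPow hζ
  have hx' : ∀ i, x i = (ωb i : K) := fun i => (hx i).trans (hωb i).symm
  rw [det_realPart_eq_of_isOfType ωb (complexConj_sqrtNegEleven hζ) hx' (norm_realUnits_pos_thirtyThree hζ)
    (complexConj_xi_thirtyThree hζ) (xi_ne_zero hζ 9) hζ' (isOfType_one_xi_top hζ 9) hT (fun i j => rfl) ha]
  exact det_realPart_xi_sqrtNegEleven hζ hx (fun i j => rfl)

open scoped Classical in
/-- **NO principal-type `E_ζ′` on `ℤ[ζ_33]` is `Φ`-positive on a `ℚ(√−11)`-signature-`(5,5)` CM type** (`s = √−11 = 1 + 2(ζ³ + ζ⁹ + ζ¹² + ζ¹⁵ + ζ²⁷)`):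
`det a = 164916224` for every skew principal-type `ζ′` (above), while van Geemen's sign would force `0 < (−1)^5 det a`
(part 92 `not_pos_of_neg_one_pow_mul_det_nonpos`) — the census NO row `(33, ℚ(√−11))` (THEOREM L there via unit
signatures) RE-DERIVED from a determinant sign.
research route conditional on HC_CM; not a corollary; Q11.4-sentence-2 already refuted in dim ≥ 3. [cite: vanGeemen1994HodgeAV, Lemma 5.2 (4)] [cite: Shimura1998, §14.3 Prop. 4–5, pp. 103–104] -/
theorem not_pos_of_principal_sqrtNegEleven [IsCyclotomicExtension {33} ℚ K] [IsCMField K] (hζ : IsPrimitiveRoot ζ 33)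
    (Φ : CMType K)
    (hneg : (Finset.univ.filter fun φ : Φ.1 => (φ.1 (1 + 2 * (ζ ^ 3 + ζ ^ 9 + ζ ^ 12 + ζ ^ 15 + ζ ^ 27))).im < 0).card = 5)
    (hposc : (Finset.univ.filter fun φ : Φ.1 => 0 < (φ.1 (1 + 2 * (ζ ^ 3 + ζ ^ 9 + ζ ^ 12 + ζ ^ 15 + ζ ^ 27))).im).card = 5)
    {ζ' : K} (hζ' : IsCMField.complexConj K ζ' = -ζ')
    (hT : CMTypeLattice.IsOfType (1 : (FractionalIdeal (𝓞 K)⁰ K)ˣ) ζ' ⊤) :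
    ¬ ∀ φ : Φ.1, 0 < (φ.1 ζ').im := by
  obtain ⟨ωb, hωb⟩ := exists_basis_thetaPow hζ
  have hs := complexConj_sqrtNegEleven hζ
  have hs0 : ((1 + 2 * (ζ ^ 3 + ζ ^ 9 + ζ ^ 12 + ζ ^ 15 + ζ ^ 27)) : K) ≠ 0 := fun h => by
    have h2 := sq_sqrtNegEleven hζ
    rw [h] at h2
    norm_num at h2
  obtain ⟨γ₀, hγ⟩ := exists_real_eq_mul_of_skew hζ' hs
  set A : Matrix (Fin 10) (Fin 10) ℚ := Matrix.of fun i j => Algebra.trace ℚ K (ζ' * (ωb i : K) *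
      IsCMField.complexConj K ((1 + 2 * (ζ ^ 3 + ζ ^ 9 + ζ ^ 12 + ζ ^ 15 + ζ ^ 27)) * (ωb j : K))) with hA
  have hA' : ∀ i j, A i j = Algebra.trace ℚ K (ζ' * (ωb i : K) *
      IsCMField.complexConj K ((1 + 2 * (ζ ^ 3 + ζ ^ 9 + ζ ^ 12 + ζ ^ 15 + ζ ^ 27)) * (ωb j : K))) := fun i j => rfl
  have hdet := det_realPart_principal_sqrtNegEleven hζ hζ' hT (x := fun i => (ωb i : K)) hωb hA'
  have hζ'0 : ζ' ≠ 0 := by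
    intro h0
    have hzero : A = 0 := by
      ext i j
      simp [hA, h0]
    rw [hzero, Matrix.det_zero] at hdet
    norm_num at hdet
  exact not_pos_of_neg_one_pow_mul_det_nonpos Φ ωb hζ' hs hs0 hζ'0 hneg hposc (fun i => rfl) hγ hA'
    (by rw [hdet]; norm_num)

/-! ### §4 Against `s₃`: invariance, census form, class SPLIT (row W10.3.1) -/

/-- **For EVERY skew `ζ′` of PRINCIPAL type on `ℤ[ζ_33]` (`IsOfType 1 ζ′ ⊤`; `ζ′ = uξ`, `u` a real unit, `N(u) = 1`
by THEOREM L (i) at `33`) the Gram determinant of `(E_ζ′, s₃)` in the frame `θ^i` (`i < 10`) is `-248832`** (such `Φ`-positive `ζ′` exist on every `ℚ(√−3)`-balanced `Φ`, `exists_principal_thirtyThree_sqrt_neg_three`): the SPLIT row for `ℚ(√−3)` at `g = 10` (census W10.3.1 `= (5, ℚ(√−3), 1)`);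
`(−1)⁵ det a > 0`, the right sign for Weil signature `(5,5)` [vG94 5.2 (4)].
research route conditional on HC_CM; not a corollary; Q11.4-sentence-2 already refuted in dim ≥ 3. [cite: vanGeemen1994HodgeAV, Lemma 5.2 (3)–(4) and (5.4.1)] [cite: Shimura1998, §14.3 Prop. 5, p. 104] -/
theorem det_realPart_principal_sqrtNegThree [IsCyclotomicExtension {33} ℚ K] [IsCMField K]
    (hζ : IsPrimitiveRoot ζ 33) {ζ' : K} (hζ' : IsCMField.complexConj K ζ' = -ζ')
    (hT : CMTypeLattice.IsOfType (1 : (FractionalIdeal (𝓞 K)⁰ K)ˣ) ζ' ⊤)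
    {x : Fin 10 → K} (hx : ∀ i, x i = (ζ + ζ⁻¹) ^ (i : ℕ)) {a : Matrix (Fin 10) (Fin 10) ℚ}
    (ha : ∀ i j, a i j = Algebra.trace ℚ K (ζ' * x i * IsCMField.complexConj K ((1 + 2 * ζ ^ 11) * x j))) :
    a.det = -248832 := by
  obtain ⟨ωb, hωb⟩ := exists_basis_thetaPow hζ
  have hx' : ∀ i, x i = (ωb i : K) := fun i => (hx i).trans (hωb i).symm
  rw [det_realPart_eq_of_isOfType ωb (complexConj_sqrtNegThree hζ) hx' (norm_realUnits_pos_thirtyThree hζ)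
    (complexConj_xi_thirtyThree hζ) (xi_ne_zero hζ 9) hζ' (isOfType_one_xi_top hζ 9) hT (fun i j => rfl) ha]
  exact det_realPart_xi_sqrtNegThree hζ hx (fun i j => rfl)

open scoped Classical in
/-- **CENSUS FORM** (the YES row `(33, ℚ(√−3))`: existence in the tree + the determinant here): for every CM type `Φ` of
`ℚ(ζ_33)` balanced for `N_K = {2, 5, 8, 14, 17, 20, 23, 26, 29, 32}`, `ℂ^Φ/Φ(ℤ[ζ_33])` carries a `Φ`-positive divisor of PRINCIPAL type, and EVERY
such divisor has van Geemen Gram determinant `-248832` in the real frame `θ^i`: the SPLIT row for `ℚ(√−3)` at `g = 10` (census W10.3.1 `= (5, ℚ(√−3), 1)`).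
research route conditional on HC_CM; not a corollary; Q11.4-sentence-2 already refuted in dim ≥ 3. [cite: vanGeemen1994HodgeAV, Lemma 5.2 (3)–(4) and (5.4.1)] [cite: Shimura1998, §14.3 Prop. 4–5, pp. 103–104] -/
theorem exists_principal_sqrtNegThree_det [IsCyclotomicExtension {33} ℚ K] [IsCMField K]
    (hζ : IsPrimitiveRoot ζ 33) (Φ : CMType K)
    (hbal : 2 * (SΦ[Φ, ζ] ∩ ({2, 5, 8, 14, 17, 20, 23, 26, 29, 32} : Finset (ZMod 33))).card = (SΦ[Φ, ζ]).card) :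
    ∃ ζ' : K, IsCMField.complexConj K ζ' = -ζ' ∧ (∀ φ : Φ.1, 0 < (φ.1 ζ').im) ∧
      CMTypeLattice.IsOfType (1 : (FractionalIdeal (𝓞 K)⁰ K)ˣ) ζ' ⊤ ∧
      ∀ (x : Fin 10 → K), (∀ i, x i = (ζ + ζ⁻¹) ^ (i : ℕ)) → ∀ a : Matrix (Fin 10) (Fin 10) ℚ,
        (∀ i j, a i j = Algebra.trace ℚ K (ζ' * x i * IsCMField.complexConj K ((1 + 2 * ζ ^ 11) * x j))) →
        a.det = -248832 := by
  obtain ⟨ζ', h1, h2, h3⟩ := exists_principal_thirtyThree_sqrt_neg_three hζ Φ hbal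
  exact ⟨ζ', h1, h2, h3, fun x hx a ha => det_realPart_principal_sqrtNegThree hζ h1 h3 hx ha⟩

/-- **`[-248832] = [−1]·[248832]` is the SPLIT class `splitDiscriminantClass 5 3` in `ℚˣ/Nm(ℚ(√−3)ˣ)`** (`248832 = 0² + 3·288² ∈ Nm`):
the principally polarised Weil-type `ℤ[ζ₃₃]`-CM tenfolds for `ℚ(√−3)` lie on the SPLIT row for `ℚ(√−3)` at `g = 10` (census W10.3.1 `= (5, ℚ(√−3), 1)`) — b02.1 (F3) for these CM points, in the kernel.
research route conditional on HC_CM; not a corollary; Q11.4-sentence-2 already refuted in dim ≥ 3. [cite: vanGeemen1994HodgeAV, 5.4 and (5.4.1)] -/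
theorem mk0_det_principal_sqrtNegThree :
    (QuotientGroup.mk (Units.mk0 (-248832 : ℚ) (by norm_num)) : weilNormResidueGroup 3) = splitDiscriminantClass 5 3 :=
  mk_neg_eq_split_of_odd (by decide) (by norm_num : (248832 : ℚ) ≠ 0)
    (mem_normUnitsSubgroup_of_sq_add_mul_sq _ (0 : ℚ) (288 : ℚ) (by norm_num))

end Summit.HodgeConjecture.Ring2WeilCoverage.WeilGramLevel33Principal

end
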